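import Mathlib.Topology.Algebra.Order.Archimedean
import Literature.Probability.RandomPlanarGeometry.TwoSidedWholePlaneSLE
import Literature.Probability.RandomPlanarGeometry.LoewnerGrowth
import HarnessLib

/-!
# Self-similarity of two-sided whole-plane SLE_κ (Zhan (2021), Cor. 4.7): deterministic lemmas

Topic `Probability/RandomPlanarGeometry`; support file for `TwoSidedWholePlaneSLEScalingProofs`
(closure of the corrected class `IsTwoSidedWholePlaneSLENatLawMeas` under dilations, towards the
named fact `IsTwoSidedWholePlaneSLENatLawMeas.map_dilatePath`, the self-similarity half of
Zhan (2021), Cor. 4.7). Five deterministic ingredients, all proved: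

* `natParamClause_dilatePath` — **scaling covariance of the Minkowski content parametrisation at
  the level of arms**: if `γ̂` is the natural parametrisation rooted at `0` of the arms `(η₁, η₂)`
  (the almost-sure clause of `IsTwoSidedWholePlaneSLENatLaw(Meas)`), then
  `D_a γ̂ = a^ν γ̂(·/a)` (`ν d = 1`) is the natural parametrisation rooted at `0` of the dilated arms
  `(a^ν η₁(· + s), a^ν η₂)`, any re-timing `s` of the first arm (`IsNaturallyParametrized.dilatePath`
  and re-timing of the two half-lines) — "the scaling covariance of the Minkowski content measure"
  in the proof of Zhan (2021), Cor. 4.7.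
* `extendFrom_eq_choice_of_not_exists` — **the junk value of `extendFrom`** (hence of
  `ConformalEquiv.boundaryExtension`) where no limit exists is the fixed constant
  `Classical.choice _`; needed because that constant does not scale, so boundary extensions of
  uniformizers are transported along dilations only up to it.
* `ratCauchy_of_tendsto`, `exists_tendsto_of_ratCauchy` — a **countable Cauchy test along the
  rational points of `ℍ`** for the existence of a boundary value at a point of the closed half-plane,
  valid for functions continuous on `ℍ` (rational points are dense in the open sets `ℍ ∩ B(x, δ)`;
  `ℂ` is complete); it makes "the uniformizer has a boundary value at `x`" a measurable condition in
  parameters.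
* `Loewner.IsGeneratedByCurve.mem_closure_setOf_mem_upperHalfPlaneSet` — **a generating curve of a
  Loewner chain with continuous driving function spends no time interval on `ℝ`**: every time is a
  limit of times at which the curve is in the open half-plane (otherwise two hulls `Kₜ ⊂ Kₛ`, `t < s`,
  would coincide, against `Loewner.hull_ssubset_hull`). Lawler (2005), Ch. 4 §4.1.
* `firstArm_regular_of_natParamClause` — **regularity of the first arm** of a natural
  parametrisation: `η₁ = 1/γ₁` (traced by `γ̂` on `(-∞, 0)`, `γ₁` a whole-plane Loewner curve from
  `0`) is continuous, tends to `0` at `+∞` and to `∞` at `-∞`, and never vanishes — the closed first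
  arm is a curve in the sphere from `∞` to `0`.

## References

* D. Zhan, *SLE loop measures*, PTRF 179 (2021), arXiv:1702.08026 (arXiv numbering), Cor. 4.7 and
  its proof (p. 23). [Zhan2021SLELoopMeasures]
* G. F. Lawler, *Conformally Invariant Processes in the Plane*, AMS (2005), Ch. 4 §4.1 (hulls
  generated by a curve). [Lawler2005]
-/

noncomputable section

open Set Filter Topology MeasureTheory Complex
open UpperHalfPlane (upperHalfPlaneSet)
open scoped NNReal Real ENNReal

namespace Literature.Probability.RandomPlanarGeometry

/-! ### Scaling covariance of the natural parametrisation, at the level of arms -/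

section Deterministic

/-- **Scaling covariance of the Minkowski content parametrisation of two arms** (deterministic).
If `γ̂` is parametrised by `d`-dimensional Minkowski content, rooted at `γ̂(0) = 0`, and traces the
arm `η₂` on `[0, ∞)` and the arm `η₁` on `(-∞, 0)` through increasing time changes (the almost-sure
clause of `IsTwoSidedWholePlaneSLENatLaw(Meas)`), then for `a > 0`, `ν d = 1` and any `s`, the
dilate `D_a γ̂ = a^ν γ̂(·/a)` (`dilatePath ν a γ̂`) is parametrised by `d`-dimensional Minkowski
content (`IsNaturallyParametrized.dilatePath`), rooted at `0`, and traces the dilated arms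
`u ↦ a^ν η₂(u)` on `[0, ∞)` and `u ↦ a^ν η₁(u + s)` on `(-∞, 0)` through increasing time changes
(divide time by `a`, then apply the old time change, then shift by `-s`). This is "the scaling
covariance of the Minkowski content measure" in the proof of Zhan (2021), Cor. 4.7, at the level of
the two arms. [cite: Zhan2021SLELoopMeasures, Cor. 4.7 (proof)] -/
theorem natParamClause_dilatePath {d ν a : ℝ} (hνd : ν * d = 1) (ha : 0 < a) (s : ℝ)
    {γ : C(ℝ, ℂ)} {η₁ : ℝ → ℂ} {η₂ : ℝ≥0 → ℂ}
    (h : IsNaturallyParametrized d γ ∧ γ 0 = 0 ∧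
      (∃ e : ℝ≥0 ≃o ℝ≥0, ∀ t : ℝ≥0, γ t = η₂ (e t)) ∧
      (∃ e' : Iio (0 : ℝ) ≃o ℝ, ∀ t : Iio (0 : ℝ), γ t = η₁ (e' t))) :
    IsNaturallyParametrized d (dilatePath ν a γ) ∧ dilatePath ν a γ 0 = 0 ∧
      (∃ e : ℝ≥0 ≃o ℝ≥0, ∀ t : ℝ≥0,
        dilatePath ν a γ t = (fun u : ℝ≥0 ↦ ((a ^ ν : ℝ) : ℂ) * η₂ u) (e t)) ∧
      (∃ e' : Iio (0 : ℝ) ≃o ℝ, ∀ t : Iio (0 : ℝ),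
        dilatePath ν a γ t = (fun u : ℝ ↦ ((a ^ ν : ℝ) : ℂ) * η₁ (u + s)) (e' t)) := by
  obtain ⟨hnat, h0, ⟨e, he⟩, ⟨e', he'⟩⟩ := h
  refine ⟨hnat.dilatePath ha hνd, by simp [h0], ?_, ?_⟩
  · -- forward half-line: divide time by `a`, then apply `e`
    let a' : ℝ≥0 := ⟨a, ha.le⟩
    have ha' : (0 : ℝ≥0) < a'⁻¹ := inv_pos.2 (by exact_mod_cast ha)
    refine ⟨(OrderIso.mulLeft₀ a'⁻¹ ha').trans e, fun t ↦ ?_⟩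
    have ht : ((t : ℝ≥0) : ℝ) / a = ((a'⁻¹ * t : ℝ≥0) : ℝ) := by
      rw [NNReal.coe_mul, NNReal.coe_inv, div_eq_inv_mul]
      rfl
    simp only [dilatePath_apply, OrderIso.trans_apply, OrderIso.mulLeft₀_apply]
    rw [ht, he]
  · -- backward open half-line: divide time by `a`, apply `e'`, shift by `-s`
    let f₀ : Iio (0 : ℝ) ≃o Iio (0 : ℝ) :=
      { toFun := fun t ↦ ⟨(t : ℝ) / a, div_neg_of_neg_of_pos t.2 ha⟩
        invFun := fun t ↦ ⟨(t : ℝ) * a, mul_neg_of_neg_of_pos t.2 ha⟩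
        left_inv := fun t ↦ Subtype.ext (div_mul_cancel₀ (t : ℝ) ha.ne')
        right_inv := fun t ↦ Subtype.ext (mul_div_cancel_right₀ (t : ℝ) ha.ne')
        map_rel_iff' := fun {t u} ↦ by
          change (t : ℝ) / a ≤ (u : ℝ) / a ↔ t ≤ u
          rw [div_le_div_iff_of_pos_right ha, Subtype.coe_le_coe] }
    refine ⟨(f₀.trans e').trans (OrderIso.addRight (-s)), fun t ↦ ?_⟩
    have hf₀ : ((f₀ t : Iio (0 : ℝ)) : ℝ) = (t : ℝ) / a := rfl
    simp only [dilatePath_apply, OrderIso.trans_apply, OrderIso.addRight_apply, neg_add_cancel_right]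
    rw [← hf₀, he']

end Deterministic

/-! ### Boundary extensions: the junk value, and a countable Cauchy test -/

section BoundaryLimits

/-- **The junk value of `extendFrom`.** Where `f` has no limit within `A`, `extendFrom A f x` is the
unspecified constant `Classical.choice _` (independent of `f`, `A`, `x` by proof irrelevance): this is
`Filter.limUnder` / `Filter.lim` = `Classical.epsilon` of an empty predicate. Used to transport the
boundary extension of a uniformizer along a dilation at the points where no boundary value exists.
[folklore] -/
theorem extendFrom_eq_choice_of_not_exists {X Y : Type*} [TopologicalSpace X] [TopologicalSpace Y]
    {A : Set X} {f : X → Y} {x : X} (h : ¬ ∃ y, Tendsto f (𝓝[A] x) (𝓝 y)) :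
    extendFrom A f x = Classical.choice ⟨f x⟩ := by
  unfold extendFrom limUnder Filter.lim Classical.epsilon Classical.strongIndefiniteDescription
  rw [dif_neg (show ¬ ∃ y, (fun z ↦ map f (𝓝[A] x) ≤ 𝓝 z) y from h)]

/-- The points of `ℂ` with rational coordinates are dense. [folklore] -/
theorem denseRange_ratPt : DenseRange (fun q : ℚ × ℚ ↦ (⟨(q.1 : ℝ), (q.2 : ℝ)⟩ : ℂ)) := by
  have h1 : DenseRange (Prod.map (Rat.cast : ℚ → ℝ) (Rat.cast : ℚ → ℝ)) :=
    Rat.denseRange_cast.prodMap Rat.denseRange_cast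
  have h2 : DenseRange (Complex.equivRealProdCLM.symm : ℝ × ℝ → ℂ) :=
    Complex.equivRealProdCLM.symm.surjective.denseRange
  have h3 := h2.comp h1 Complex.equivRealProdCLM.symm.continuous
  convert h3 using 1
  funext q
  apply Complex.ext <;> simp [Complex.equivRealProdCLM_symm_apply]

/-- If `f` has a limit at `x` within `ℍ`, then `f` passes the **countable Cauchy test along the
rational points of `ℍ`** at `x`: for every `n` there is `m` such that any two rational points of `ℍ`
within `1/(m+1)` of `x` have `f`-values within `1/(n+1)`. [folklore] -/
theorem ratCauchy_of_tendsto {f : ℂ → ℂ} {x y : ℂ} (h : Tendsto f (𝓝[upperHalfPlaneSet] x) (𝓝 y)) :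
    ∀ n : ℕ, ∃ m : ℕ, ∀ q q' : ℚ × ℚ, 0 < q.2 → 0 < q'.2 →
      dist (⟨(q.1 : ℝ), (q.2 : ℝ)⟩ : ℂ) x < 1 / ((m : ℝ) + 1) →
        dist (⟨(q'.1 : ℝ), (q'.2 : ℝ)⟩ : ℂ) x < 1 / ((m : ℝ) + 1) →
          dist (f ⟨(q.1 : ℝ), (q.2 : ℝ)⟩) (f ⟨(q'.1 : ℝ), (q'.2 : ℝ)⟩) ≤ 1 / ((n : ℝ) + 1) := by
  intro n
  have hε : (0 : ℝ) < 1 / ((n : ℝ) + 1) / 2 := by positivity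
  obtain ⟨δ, hδ, hball⟩ := Metric.tendsto_nhdsWithin_nhds.1 h _ hε
  obtain ⟨m, hm⟩ := exists_nat_one_div_lt hδ
  refine ⟨m, fun q q' hq hq' hqx hq'x ↦ ?_⟩
  have hmem : ∀ p : ℚ × ℚ, 0 < p.2 → (⟨(p.1 : ℝ), (p.2 : ℝ)⟩ : ℂ) ∈ upperHalfPlaneSet :=
    fun p hp ↦ by
      change (0 : ℝ) < (p.2 : ℝ)
      exact_mod_cast hp
  have h1 := hball (hmem q hq) (hqx.trans hm)
  have h2 := hball (hmem q' hq') (hq'x.trans hm)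
  calc dist (f ⟨(q.1 : ℝ), (q.2 : ℝ)⟩) (f ⟨(q'.1 : ℝ), (q'.2 : ℝ)⟩)
      ≤ dist (f ⟨(q.1 : ℝ), (q.2 : ℝ)⟩) y + dist (f ⟨(q'.1 : ℝ), (q'.2 : ℝ)⟩) y :=
        dist_triangle_right _ _ _
    _ ≤ 1 / ((n : ℝ) + 1) / 2 + 1 / ((n : ℝ) + 1) / 2 := add_le_add h1.le h2.le
    _ = 1 / ((n : ℝ) + 1) := by ring

/-- Conversely, for `f` continuous on `ℍ` and `x` in the closed half-plane, the countable Cauchy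
test along the rational points of `ℍ` at `x` gives a limit of `f` at `x` within `ℍ`: rational points
are dense in the open sets `ℍ ∩ B(x, δ)`, continuity passes the Cauchy estimate to all their points,
and `ℂ` is complete. So, for such `f`, the existence of a boundary value at `x` is a countable
condition on the values of `f` at rational points — whence measurable in parameters. [folklore] -/
theorem exists_tendsto_of_ratCauchy {f : ℂ → ℂ} (hf : ContinuousOn f upperHalfPlaneSet) {x : ℂ}
    (hx : x ∈ closure upperHalfPlaneSet)
    (h : ∀ n : ℕ, ∃ m : ℕ, ∀ q q' : ℚ × ℚ, 0 < q.2 → 0 < q'.2 →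
      dist (⟨(q.1 : ℝ), (q.2 : ℝ)⟩ : ℂ) x < 1 / ((m : ℝ) + 1) →
        dist (⟨(q'.1 : ℝ), (q'.2 : ℝ)⟩ : ℂ) x < 1 / ((m : ℝ) + 1) →
          dist (f ⟨(q.1 : ℝ), (q.2 : ℝ)⟩) (f ⟨(q'.1 : ℝ), (q'.2 : ℝ)⟩) ≤ 1 / ((n : ℝ) + 1)) :
    ∃ y, Tendsto f (𝓝[upperHalfPlaneSet] x) (𝓝 y) := by
  haveI : NeBot (𝓝[upperHalfPlaneSet] x) := mem_closure_iff_nhdsWithin_neBot.1 hx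
  suffices hC : Cauchy (map f (𝓝[upperHalfPlaneSet] x)) by
    obtain ⟨y, hy⟩ := CompleteSpace.complete hC
    exact ⟨y, hy⟩
  rw [Metric.cauchy_iff]
  refine ⟨inferInstance, fun ε hε ↦ ?_⟩
  obtain ⟨n, hn⟩ := exists_nat_one_div_lt hε
  obtain ⟨m, hm⟩ := h n
  set δ : ℝ := 1 / ((m : ℝ) + 1) with hδ
  have hδpos : 0 < δ := by positivity
  set U : Set ℂ := upperHalfPlaneSet ∩ Metric.ball x δ with hU
  have hUo : IsOpen U := UpperHalfPlane.isOpen_upperHalfPlaneSet.inter Metric.isOpen_ball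
  set R : Set ℂ := range fun q : ℚ × ℚ ↦ (⟨(q.1 : ℝ), (q.2 : ℝ)⟩ : ℂ) with hR
  have hcl : U ⊆ closure (U ∩ R) := denseRange_ratPt.open_subset_closure_inter hUo
  have hUR : ∀ w ∈ U ∩ R, ∃ q : ℚ × ℚ, 0 < q.2 ∧ dist (⟨(q.1 : ℝ), (q.2 : ℝ)⟩ : ℂ) x < δ ∧
      (⟨(q.1 : ℝ), (q.2 : ℝ)⟩ : ℂ) = w := by
    rintro w ⟨⟨hwH, hwB⟩, q, rfl⟩
    refine ⟨q, ?_, Metric.mem_ball.1 hwB, rfl⟩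
    have : (0 : ℝ) < (q.2 : ℝ) := hwH
    exact_mod_cast this
  -- one variable rational, the other arbitrary
  have hstepA : ∀ z ∈ U, ∀ w' ∈ U ∩ R, dist (f z) (f w') ≤ 1 / ((n : ℝ) + 1) := by
    intro z hz w' hw'
    obtain ⟨q', hq', hq'x, rfl⟩ := hUR w' hw'
    haveI : NeBot (𝓝[U ∩ R] z) := mem_closure_iff_nhdsWithin_neBot.1 (hcl hz)
    have hcont : Tendsto (fun w ↦ dist (f w) (f ⟨(q'.1 : ℝ), (q'.2 : ℝ)⟩)) (𝓝[U ∩ R] z)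
        (𝓝 (dist (f z) (f ⟨(q'.1 : ℝ), (q'.2 : ℝ)⟩))) :=
      ((hf z hz.1).mono_left (nhdsWithin_mono z fun w hw ↦ hw.1.1)).dist tendsto_const_nhds
    refine le_of_tendsto hcont ?_
    filter_upwards [self_mem_nhdsWithin] with w hw
    obtain ⟨q, hq, hqx, rfl⟩ := hUR w hw
    exact hm q q' hq hq' hqx hq'x
  -- both variables arbitrary
  have hstepB : ∀ z ∈ U, ∀ z' ∈ U, dist (f z) (f z') ≤ 1 / ((n : ℝ) + 1) := by
    intro z hz z' hz'
    haveI : NeBot (𝓝[U ∩ R] z') := mem_closure_iff_nhdsWithin_neBot.1 (hcl hz')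
    have hcont : Tendsto (fun w' ↦ dist (f z) (f w')) (𝓝[U ∩ R] z') (𝓝 (dist (f z) (f z'))) :=
      tendsto_const_nhds.dist ((hf z' hz'.1).mono_left (nhdsWithin_mono z' fun w hw ↦ hw.1.1))
    refine le_of_tendsto hcont ?_
    filter_upwards [self_mem_nhdsWithin] with w' hw'
    exact hstepA z hz w' hw'
  refine ⟨f '' U, image_mem_map (inter_mem_nhdsWithin _ (Metric.ball_mem_nhds x hδpos)), ?_⟩
  rintro _ ⟨z, hz, rfl⟩ _ ⟨z', hz', rfl⟩
  exact (hstepB z hz z' hz').trans_lt hn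

end BoundaryLimits

/-! ### The Loewner trace spends no time interval on the real line -/

section Trace

/-- **A generating curve of a Loewner chain with continuous driving function spends no time interval
on the real line**: every time `t` is a limit of times at which the curve is in the OPEN half-plane.
Otherwise the curve stays on `ℝ` throughout some `[t, s]`, `t < s`, so that `ℍₒ ∖ γ[0, s] = ℍₒ ∖ γ[0, t]`
and the hulls `Kₛ = Kₜ` coincide (`IsGeneratedByCurve.hull_eq`), contradicting their strict growth
(`Loewner.hull_ssubset_hull`). Lawler (2005), Ch. 4 §4.1. [folklore] -/
theorem Loewner.IsGeneratedByCurve.mem_closure_setOf_mem_upperHalfPlaneSet {W : ℝ≥0 → ℝ}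
    {γ : ℝ≥0 → ℂ} (hW : Continuous W) (h : Loewner.IsGeneratedByCurve W γ) (t : ℝ≥0) :
    t ∈ closure {s : ℝ≥0 | γ s ∈ upperHalfPlaneSet} := by
  by_contra ht
  rw [mem_closure_iff_nhds] at ht
  push Not at ht
  obtain ⟨V, hV, hVU⟩ := ht
  obtain ⟨ε, hε, hball⟩ := Metric.mem_nhds_iff.1 hV
  -- on `[t, t + ε/2]` the curve is real
  let ε' : ℝ≥0 := ⟨ε / 2, by positivity⟩
  have hε' : (0 : ℝ≥0) < ε' := by
    rw [← NNReal.coe_pos]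
    exact half_pos hε
  set s : ℝ≥0 := t + ε' with hs
  have hts : t < s := lt_add_of_pos_right t hε'
  have hreal : ∀ u ∈ Icc t s, γ u ∉ upperHalfPlaneSet := by
    intro u hu hmem
    have hu1 : (t : ℝ) ≤ u := by exact_mod_cast hu.1
    have hu2 : (u : ℝ) ≤ t + ε / 2 := by exact_mod_cast hu.2
    have huV : u ∈ V := hball (by
      rw [Metric.mem_ball, NNReal.dist_eq, abs_of_nonneg (by linarith)]
      linarith)
    have : u ∈ V ∩ {s | γ s ∈ upperHalfPlaneSet} := ⟨huV, hmem⟩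
    rw [hVU] at this
    exact this
  -- hence the hulls at `t` and `s` coincide
  have hdiff : upperHalfPlaneSet \ γ '' Icc 0 s = upperHalfPlaneSet \ γ '' Icc 0 t := by
    rw [← Icc_union_Icc_eq_Icc (zero_le : (0 : ℝ≥0) ≤ t) hts.le, image_union, ← Set.sdiff_sdiff, sdiff_eq_left]
    exact Set.disjoint_left.2 fun z hz hz' ↦ by
      obtain ⟨u, hu, rfl⟩ := hz'
      exact hreal u hu hz.1
  have hK : Loewner.hull W s = Loewner.hull W t := by
    rw [h.hull_eq s, h.hull_eq t, hdiff]
  exact (Loewner.hull_ssubset_hull hW hts).ne hK.symm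

end Trace

/-! ### Regularity of the first arm of a natural parametrisation -/

section FirstArm

/-- **Regularity of the first arm, from the natural parametrisation** (deterministic). If `γ̂` is
parametrised by `d`-dimensional Minkowski content, rooted at `γ̂(0) = 0`, and traces on `(-∞, 0)` the
arm `η = 1/γ₁` through an increasing time change onto `ℝ`, where `γ₁` is continuous with
`γ₁(t) → 0` as `t → -∞` (a whole-plane Loewner curve from `0`, `WholePlaneLoewnerChain.IsCurve`), then:
`η` is continuous (it is `γ̂ ∘ e'⁻¹`); `η(t) → 0 = γ̂(0)` as `t → +∞`; `γ₁` never vanishes — its zero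
set is closed, open (at a zero `t₀` of `γ₁` accumulated by non-zeros, `η = 1/γ₁` would be unbounded
near `t₀`, against its continuity) and not all of `ℝ` (else `γ̂ ≡ 0` on `[-1, 0]`, whose Minkowski
content would be both `1` and `0`) — so `η(t) ≠ 0` for all `t` and `η(t) → ∞` as `t → -∞`. Thus the
closed first arm `{0} ∪ η(ℝ) ∪ {∞}` of a two-sided whole-plane SLE_κ natural law is a curve in the
sphere from `∞` to `0`, the input of the boundary-regularity hypothesis of
`TwoSidedWholePlaneSLEScalingProofs`. [folklore] -/
theorem firstArm_regular_of_natParamClause {d : ℝ} {γ : C(ℝ, ℂ)} {η γ₁ : ℝ → ℂ}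
    (hnat : IsNaturallyParametrized d γ) (h0 : γ 0 = 0)
    (he' : ∃ e' : Iio (0 : ℝ) ≃o ℝ, ∀ t : Iio (0 : ℝ), γ t = η (e' t))
    (hη : ∀ t, η t = (γ₁ t)⁻¹) (hγ₁c : Continuous γ₁) (hγ₁0 : Tendsto γ₁ atBot (𝓝 0)) :
    Continuous η ∧ Tendsto η atTop (𝓝 0) ∧ Tendsto η atBot (cocompact ℂ) ∧ ∀ t, η t ≠ 0 := by
  obtain ⟨e', he'⟩ := he'
  -- `η = γ ∘ e'⁻¹` on `(-∞, 0)`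
  have hηeq : η = fun u ↦ γ ((e'.symm u : Iio (0 : ℝ)) : ℝ) := by
    funext u
    rw [he', OrderIso.apply_symm_apply]
  have hcont : Continuous η := by
    rw [hηeq]
    exact γ.continuous.comp (continuous_subtype_val.comp e'.symm.continuous)
  have htop : Tendsto η atTop (𝓝 0) := by
    rw [hηeq]
    have h1 : Tendsto (fun u ↦ (e'.symm u : Iio (0 : ℝ))) atTop atTop := e'.symm.tendsto_atTop
    have h2 : Tendsto (fun t : Iio (0 : ℝ) ↦ (t : ℝ)) atTop (𝓝[<] 0) :=
      (tendsto_comp_coe_Iio_atTop (f := fun x : ℝ ↦ x) (l := 𝓝[<] (0 : ℝ))).2 tendsto_id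
    have h3 : Tendsto γ (𝓝[<] 0) (𝓝 0) := by
      simpa only [h0] using ((γ.continuous.tendsto 0).mono_left nhdsWithin_le_nhds)
    exact h3.comp (h2.comp h1)
  -- `γ₁` never vanishes: its zero set is clopen and not everything
  have hZclosed : IsClosed {t : ℝ | γ₁ t = 0} := isClosed_eq hγ₁c continuous_const
  have hZopen : IsOpen {t : ℝ | γ₁ t = 0} := by
    rw [isOpen_iff_mem_nhds]
    intro t₀ ht₀
    by_contra hcon
    -- points with `γ₁ ≠ 0` accumulate at `t₀`
    have hfreq : ∃ᶠ t in 𝓝 t₀, γ₁ t ≠ 0 := by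
      rw [Filter.Frequently]
      exact fun hev ↦ hcon (by filter_upwards [hev] with t ht using not_not.1 ht)
    have hcl : t₀ ∈ closure {t : ℝ | γ₁ t ≠ 0} := by
      rw [mem_closure_iff_frequently]
      exact hfreq
    haveI : NeBot (𝓝[{t : ℝ | γ₁ t ≠ 0}] t₀) := mem_closure_iff_nhdsWithin_neBot.1 hcl
    have hγ₁t : Tendsto γ₁ (𝓝[{t : ℝ | γ₁ t ≠ 0}] t₀) (𝓝[≠] 0) := by
      refine tendsto_nhdsWithin_iff.2 ⟨?_, eventually_of_mem self_mem_nhdsWithin fun t ht ↦ ht⟩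
      have := (hγ₁c.tendsto t₀).mono_left (nhdsWithin_le_nhds (s := {t : ℝ | γ₁ t ≠ 0}))
      rwa [show γ₁ t₀ = 0 from ht₀] at this
    have hbig : Tendsto η (𝓝[{t : ℝ | γ₁ t ≠ 0}] t₀) (cocompact ℂ) := by
      rw [← Metric.cobounded_eq_cocompact, show η = Inv.inv ∘ γ₁ from funext hη]
      exact Filter.tendsto_inv₀_nhdsNE_zero.comp hγ₁t
    have hsmall : Tendsto η (𝓝[{t : ℝ | γ₁ t ≠ 0}] t₀) (𝓝 (η t₀)) :=
      (hcont.tendsto t₀).mono_left nhdsWithin_le_nhds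
    exact hsmall.not_tendsto (disjoint_nhds_cocompact (η t₀)) hbig
  have hZ : {t : ℝ | γ₁ t = 0} = ∅ := by
    rcases isClopen_iff.1 ⟨hZclosed, hZopen⟩ with h | h
    · exact h
    · exfalso
      -- then `η ≡ 0`, so `γ ≡ 0` on `[-1, 0]`, against the natural parametrisation
      have hη0 : ∀ t, η t = 0 := fun t ↦ by
        have : γ₁ t = 0 := by
          have ht : t ∈ {t : ℝ | γ₁ t = 0} := by rw [h]; exact mem_univ t
          exact ht
        rw [hη, this, inv_zero]
      have himage : γ '' Icc (-1 : ℝ) 0 = {γ 0} := by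
        refine Subset.antisymm ?_ (singleton_subset_iff.2 ⟨0, ⟨by norm_num, le_rfl⟩, rfl⟩)
        rintro _ ⟨t, ht, rfl⟩
        rw [mem_singleton_iff, h0]
        rcases eq_or_lt_of_le ht.2 with rfl | hlt
        · exact h0
        · rw [he' ⟨t, hlt⟩, hη0]
      have h1 : HasMinkowskiContent d (γ '' Icc (-1 : ℝ) 0) (ENNReal.ofReal (0 - (-1))) :=
        hnat (-1) 0 (by norm_num)
      rw [himage] at h1
      have h2 := hnat.hasMinkowskiContent_singleton 0
      have := tendsto_nhds_unique h1 h2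
      norm_num at this
  have hne : ∀ t, γ₁ t ≠ 0 := fun t ht ↦ by
    have : t ∈ ({t : ℝ | γ₁ t = 0} : Set ℝ) := ht
    rw [hZ] at this
    exact this
  refine ⟨hcont, htop, ?_, fun t ↦ by rw [hη]; exact inv_ne_zero (hne t)⟩
  rw [← Metric.cobounded_eq_cocompact, show η = Inv.inv ∘ γ₁ from funext hη]
  exact Filter.tendsto_inv₀_nhdsNE_zero.comp
    (tendsto_nhdsWithin_iff.2 ⟨hγ₁0, Eventually.of_forall hne⟩)

end FirstArm

end Literature.Probability.RandomPlanarGeometry
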